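import Literature.Computability.QuantumComplexity.BosonSamplingHardness
import Literature.Computability.Cryptography.SamplingProblemsProofs
import Literature.Computability.Complexity.ApproximateCounting
import Literature.Computability.Complexity.CountingHierarchyProofs
import Literature.Computability.Complexity.StringEquality
import Literature.Computability.Complexity.PairingMachines
import Literature.Computability.Complexity.OracleEmpty
import HarnessLib
import HarnessLib.Audit

/-!
# Exact BosonSampling: the Aaronson–Arkhipov hardness chain (AA13 Thm. 1.1, §4.1)

Family `quantum-advantage`; companion to `Sampling.lean` (statement **quantum-advantage.S20**,
formerly vendored there as `PSharpP_subset_BPPRelClass_NP_of_exactBosonSampling` — mis-stated, see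
below, and deleted from `Sampling.lean` on 2026-08-14 in favour of the corrected statement
`PSharpP_subset_BPPRelClass_NP_of_uniformExactBosonSampling` of this file) and to
`BosonSamplingHardness.lean` (the approximate case S21). Source: S. Aaronson, A. Arkhipov, *The
computational complexity of linear optics*, Theory of Computing 9 (2013) 143–252 (AA13, journal
pagination): Thm. 1.1 p. 149, Def. 2.4 p. 163, Thm. 3.10 p. 171, §4.1 pp. 175–178 (Thm. 4.1
Stockmeyer, Thm. 4.2 Valiant, Thm. 4.3 hardness of approximating `Per(X)²`, Lemma 4.4 unitary
embedding, proof of Thm. 1.1 eqs. (4.20)–(4.23), Cor. 4.5).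

AA13's proof of Thm. 1.1 (p. 178): given `X ∈ ℝ^{n×n}`, by Thm. 4.3 it suffices to approximate
`Per(X)²` to within a constant factor in `FBPP^{NP^𝒪}`; embed `εX` as the top block of a
column-orthonormal `A` (Lemma 4.4), so that the probability of the outcome `1_n` under `𝒟_A` is
`p_A = ε^{2n} Per(X)²` (Thm. 3.10, eqs. (4.20)–(4.23)); `p_A = Pr_r[𝒪(A, r) = 1_n]` is the
acceptance probability of a deterministic polynomial-time predicate of the sampler's coins `r`, so
Stockmeyer's approximate counting (Thm. 4.1) estimates it to within any factor `1 + 1/poly` in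
`FBPP^{NP^𝒪}`.

This file

* **proves the linear-optical part of the chain for the tree's exact-dyadic instance family**:
  for an integer matrix `X` it constructs an *exactly* column-orthonormal matrix with entries in
  `2^{-t} ℤ` whose top `n × n` block is `2^{-t} X` (`gramEntries`, `isColumnOrthonormal_gram`;
  this replaces Lemma 4.4, whose Cholesky factor `√(I − YᴴY)` is irrational, and removes for S20
  the "exact dyadic orthonormal completion" proviso of `Sampling.lean`'s module docstring), and
  proves the outcome identity `𝒟_A(1_n) = Per(X)² / (4^{tn} n!)` on the encoded instance
  (`toReal_bosonSamplingProblem_gramInstance`, eqs. (4.20)–(4.23));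
* **proves the arithmetic of the estimate**: a factor-`c` sampler and a factor-`2` count of its
  coins give, after rescaling and rounding up, an integer within the factor `2c + 1` of `Per(X)²`
  (`bosonRescale_mem_perSqWindow`; integrality of `Per(X)²` absorbs the rounding);
* vendors the two complexity-theoretic ingredients as named facts in the tree's oracle model —
  AA13 Thm. 4.3 in the randomised-oracle form in which the proof of Thm. 1.1 consumes it
  (`PSharpP_subset_BPPRel_of_perSqRandOracleSolves`: a coin-taking oracle approximating `Per(X)²`
  of integer matrices to within a constant factor gives `P^{#P} ⊆ BPP^{𝒪}`), and three folklore
  polynomial-time book-keeping facts (`samplerRel_mem_P` — discharged here,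
  `samplerRel_mem_P_holds`, with the string-equality test `EqPair ∈ P` of
  `Complexity/StringEquality.lean` —, `FPRel_comp_FP` — discharged, `FPRel_comp_FP_holds`, by the
  transcript-model closure `postPre_mem_FPRel` of `Complexity/OracleClosure.lean` —,
  `bosonReduction_mem_FP`); Stockmeyer's theorem itself is the tree's `stockmeyerApproxCounting`
  (`ApproximateCounting.lean`), `P^∅ = P` is `PRel_empty` (`Oracle.lean`, discharged in
  `Complexity/OracleEmpty.lean`) and `P^{FP^O} ⊆ P^O` is the tree's `PRel_subset_PRel_of_mem_FPRel`
  (`BosonSamplingHardness.lean`);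
* records why S20 as originally vendored was **mis-stated** (below), vendors the corrected statement
  `PSharpP_subset_BPPRelClass_NP_of_uniformExactBosonSampling`, and **proves** it from the named
  facts exactly along AA13's proof (`PSharpP_subset_BPPRelClass_NP_of_uniformExactBosonSampling_of_facts`).

## Why S20 was mis-stated (uniformity of the sampler)

S20 read `(∃ A, IsPPT A id ∧ ∃ c ≥ 1, A.SamplesMultiplicative bosonSamplingProblem c) →
PSharpP ⊆ BPPRelClass NP` (retired from `Sampling.lean` on 2026-08-14). In the tree `IsPPT A id`
(= `RandAlg.IsPolyTime`) only *bounds* the coin budget, `A.coinLen ≤ poly`; `RandAlg.outputPMF`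
feeds exactly `coinLen |x|` coins and `A.run` may read `|r|`, so such a sampler receives the
possibly non-computable number `coinLen |x|`, i.e. `O(log |x|)` bits of advice
(`ProbabilisticClasses.lean`, module docstring and `mem_BPP_iff_randAlg`: "a bounded but
non-computable budget would leak one uncomputable bit per input length"). AA13's Thm. 1.1 is
about a classical randomised *algorithm* — "a deterministic algorithm that takes a random string
`r` as part of its input" (p. 149), `r ∈ {0,1}^{poly(n)}` — and its proof applies Stockmeyer
counting (Thm. 4.1) to the Boolean function `r ↦ [𝒪(A, r) = 1_n]` on `{0,1}^{poly(n)}`: the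
`BPP^{NP}` machine must know the number of coins.
With an advice-taking sampler the printed proof yields only `P^{#P} ⊆ BPP^{NP}/log`; removing the
advice would need an argument that is not in AA13 (e.g. a program checker for the permanent). As
for `BPP` (`mem_BPP_iff_randAlg`), for S21 (`UniformApproxBosonSampling`) and for S22
(`UniformIQPMultiplicativeSimulation`), the corrected hypothesis `UniformExactBosonSampling` adds
the exact-polynomial coin budget `∃ q, ∀ n, A.coinLen n = q.eval n`. Nothing else changes: in
particular the restriction of `bosonSamplingProblem` to exactly column-orthonormal dyadic
instances is harmless for the *exact* case, because the reduction chooses its instances and the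
instances constructed here are exactly dyadic (first bullet above).

## Design choices

* **Coin-taking oracles.** As in `BosonSamplingHardness.lean` (`GPERandOracleSolves`), a
  randomised oracle is a deterministic `𝒪 : Oracle` queried on `⟨⟨q, 1^k⟩, u⟩`: the instance `q`
  (here the code of a square integer matrix, `encodingIntMatrix`), the confidence parameter
  `k = 1/δ` in unary (AA13 Def. 2.4: "given `⟨x, 0^{1/ε}⟩`") and the coin string `u`, chosen by the
  querying machine (Thm. 1.1, p. 149: "the `BPP^{NP}` machine gets to fix the random bits used by
  `𝒪`"). `PerSqRandOracleSolves g 𝒪` asks that for `n ≥ 1` the answer, read as a natural number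
  (`Computability.decodeNat`), lie in the window `[Per(X)²/g, g · Per(X)²]` (AA13 eq. (4.2)) except
  for a fraction `≤ 1/k` of the coin strings `u ∈ {0,1}^ℓ`, for *every* `ℓ ≥ c(|q| + k)` (`c` a
  polynomial of the oracle: it reads a prefix of its random tape). Integer answers lose nothing
  (`Per(X)²` itself qualifies, `sq_permanent_mem_perSqWindow`).
* **The instances.** For `X ∈ ℤ^{n×n}` and precision `t` the instance has `n + n² + 3n(t+1)` modes:
  below the block `X` one row per ordered pair `(a, b)`, carrying `(⟨x_a, x_b⟩, −1)` in columns
  `a < b` (this kills the Gram entry `⟨x_a, x_b⟩` and adds `⟨x_a,x_b⟩²` resp. `1` to the two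
  diagonal entries), and `3(t+1)` private rows per column writing the deficit `4^t − ‖column‖²` in
  base `4` with digits realised as `d` copies of `2^{level}` (`d ≤ 3`); all entries are integers, and
  dividing by `2^t` (`dyadicComplex t (z, 0)`) gives `AᴴA = 1` exactly (`sum_gramRows_mul`). The
  precision `t = gramPrecision X` is the least making all deficits nonnegative.
* **Ordered outcomes.** The tree's `bosonSamplingProblem` is over ordered mode assignments; the
  planted outcome is `s = (0, 1, …, n−1)` (photon `i` in mode `i`), whose weight is
  `|Per(A_s)|²/n!` with `A_s = 2^{-t} X`, i.e. `Per(X)²/(4^{tn} n!)` — AA13's `|Per(U_{n,n})|²`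
  (eq. (4.22)) up to the `1/n!` of the ordered refinement, a known factor absorbed by the rescaling.
* **What is used from the tree.** `stockmeyerApproxCounting` (relativised Stockmeyer, with the
  empty oracle), `PRel_empty` (`P^∅ = P`, to read `NP^∅` as `NP`), `PRel_subset_PRel_of_mem_FPRel`
  (`P^{FP^L} ⊆ P^L`) and `bosonSamplingPMF_apply` (the normalisation `𝒟_A(s) = |Per(A_s)|²/n!`)
  enter the assembly as hypotheses `(h : <fact>)`, as do the four facts vendored here; the
  normalisation is discharged in `Cryptography/SamplingProblemsProofs.lean`
  (`bosonSamplingPMF_apply_holds`), which the primed assembly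
  `PSharpP_subset_BPPRelClass_NP_of_uniformExactBosonSampling_of_facts'` feeds in.

## What a discharge of the remaining facts would need (not done here)

`PSharpP_subset_BPPRel_of_perSqRandOracleSolves`: Valiant's `#P`-completeness of the 0/1
permanent (Thm. 4.2) and AA13's binary search (4.3)–(4.19) as an oracle machine in the transcript
model of `Oracle.lean`, with the real bracket `β` of (4.9) replaced by a rational upper bound and
the query `X^{[r]}` made integral by clearing the denominator of its first row, plus a union bound
over the `O(g n² log n)` randomised queries. The three book-keeping facts are compositions of
polynomial-time machines (`PolyTimeComputable.comp_holds`) with the pairing projections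
(`PairProjections.lean`), a string-equality test, and the arithmetic of `gramEntries`,
`gramPrecision` and `bosonRescale`.
-/

open MeasureTheory Matrix Computability Literature.Computability.Complexity Literature.Computability.Complexity.Nondeterministic Literature.Computability.Complexity.Classes Literature.Computability.Cryptography Finset

namespace Literature.Computability.QuantumComplexity

/-! ### An exactly dyadic column-orthonormal embedding of an integer matrix (replaces AA13 Lemma 4.4) -/

section GramCompletion

variable {n : ℕ}

/-- The Gram entries of the columns of `X`: `colGram X j k = ⟨x_j, x_k⟩ = ∑ᵢ X i j · X i k`. [folklore] -/
def colGram (X : Matrix (Fin n) (Fin n) ℤ) (j k : Fin n) : ℤ := ∑ i, X i j * X i k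

/-- `colGram` is symmetric. [folklore] -/
theorem colGram_comm (X : Matrix (Fin n) (Fin n) ℤ) (j k : Fin n) : colGram X j k = colGram X k j := by
  unfold colGram
  exact Finset.sum_congr rfl fun i _ => mul_comm _ _

/-- Diagonal Gram entries are nonnegative. [folklore] -/
theorem colGram_self_nonneg (X : Matrix (Fin n) (Fin n) ℤ) (j : Fin n) : 0 ≤ colGram X j j :=
  Finset.sum_nonneg fun _ _ => mul_self_nonneg _

/-- The diagonal Gram entry of column `j` after the pair rows have been appended:
`‖x_j‖² + ∑_{k > j} ⟨x_j, x_k⟩² + #{k < j}`. [folklore] -/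
def pairDiag (X : Matrix (Fin n) (Fin n) ℤ) (j : Fin n) : ℤ :=
  colGram X j j + ∑ k : Fin n, (if j < k then colGram X j k ^ 2 else 0) +
    ∑ k : Fin n, (if k < j then (1 : ℤ) else 0)

/-- `pairDiag X j ≥ 0`. [folklore] -/
theorem pairDiag_nonneg (X : Matrix (Fin n) (Fin n) ℤ) (j : Fin n) : 0 ≤ pairDiag X j := by
  unfold pairDiag
  refine add_nonneg (add_nonneg (colGram_self_nonneg X j) (Finset.sum_nonneg fun k _ => ?_))
    (Finset.sum_nonneg fun k _ => ?_)
  · split_ifs <;> positivity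
  · split_ifs <;> norm_num

/-- The canonical precision of the embedding of `X`: the least `t` (up to one) with
`4^t ≥ pairDiag X j` for all `j`, namely `⌊log₄ (∑ⱼ pairDiag X j)⌋ + 1`. [folklore] -/
def gramPrecision (X : Matrix (Fin n) (Fin n) ℤ) : ℕ := Nat.log 4 (∑ j, (pairDiag X j).toNat) + 1

/-- Every `pairDiag X j` is at most `4 ^ gramPrecision X`. [folklore] -/
theorem pairDiag_le_gramPrecision (X : Matrix (Fin n) (Fin n) ℤ) (j : Fin n) :
    pairDiag X j ≤ 4 ^ gramPrecision X := by
  have h1 : (pairDiag X j).toNat ≤ ∑ k, (pairDiag X k).toNat :=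
    Finset.single_le_sum (f := fun k => (pairDiag X k).toNat) (fun k _ => Nat.zero_le _)
      (Finset.mem_univ j)
  have h2 : ∑ k, (pairDiag X k).toNat < 4 ^ gramPrecision X :=
    Nat.lt_pow_succ_log_self (by norm_num) _
  have h3 : (pairDiag X j) = ((pairDiag X j).toNat : ℤ) :=
    (Int.toNat_of_nonneg (pairDiag_nonneg X j)).symm
  rw [h3]
  exact_mod_cast (h1.trans h2.le)

/-- The deficit of column `j` at precision `t`: `4^t − pairDiag X j` (as a natural number; the
construction is used only when `pairDiag X j ≤ 4^t`). [folklore] -/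
def gramDeficit (X : Matrix (Fin n) (Fin n) ℤ) (t : ℕ) (j : Fin n) : ℕ := (4 ^ t - pairDiag X j).toNat

/-- The base-`4` digit of `d` at position `lvl`. [folklore] -/
def base4Digit (d lvl : ℕ) : ℕ := d / 4 ^ lvl % 4

/-- Base-`4` digits are `< 4`. [folklore] -/
theorem base4Digit_lt (d lvl : ℕ) : base4Digit d lvl < 4 := Nat.mod_lt _ (by norm_num)

/-- Base-`4` expansion: `∑_{lvl < T} digit_lvl(d) · 4^lvl = d` for `d < 4^T`. [folklore] -/
theorem sum_base4Digit_mul_pow : ∀ (T d : ℕ), d < 4 ^ T →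
    ∑ lvl : Fin T, base4Digit d lvl * 4 ^ (lvl : ℕ) = d
  | 0, d, hd => by simp at hd; simp [hd]
  | T + 1, d, hd => by
    rw [Fin.sum_univ_succ]
    simp only [Fin.val_zero, pow_zero, mul_one, Fin.val_succ, base4Digit]
    have ih := sum_base4Digit_mul_pow T (d / 4) (by
      rw [Nat.div_lt_iff_lt_mul (by norm_num)]; simpa [pow_succ] using hd)
    simp only [base4Digit] at ih
    have : ∀ lvl : Fin T, d / 4 ^ ((lvl : ℕ) + 1) % 4 * 4 ^ ((lvl : ℕ) + 1) =
        4 * (d / 4 / 4 ^ (lvl : ℕ) % 4 * 4 ^ (lvl : ℕ)) := by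
      intro lvl
      rw [Nat.div_div_eq_div_mul, pow_succ]
      ring_nf
    rw [Finset.sum_congr rfl fun lvl _ => this lvl, ← Finset.mul_sum, ih]
    simp only [Nat.div_one]
    omega

/-- `∑_{l : Fin 3} [l < m] · c = m · c` for `m < 4`. [folklore] -/
theorem sum_fin_three_ite_lt (m : ℕ) (hm : m < 4) (c : ℤ) :
    ∑ l : Fin 3, (if (l : ℕ) < m then c else 0) = m * c := by
  interval_cases m
  · simp
  · simp
  · simp [Fin.sum_univ_three]; ring
  · simp

/-- Row indices of the embedding: the `n` rows of `X`, one row per ordered pair of columns, and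
`3 (t + 1)` private rows per column. [folklore] -/
abbrev GramRow (n t : ℕ) : Type := Fin n ⊕ (Fin n × Fin n ⊕ Fin n × (Fin (t + 1) × Fin 3))

/-- The integer rows of the embedding of `X` at precision `t` (module docstring, "The instances"):
the block `X`; for `a < b` the pair row with `⟨x_a, x_b⟩` in column `a` and `−1` in column `b`
(rows with `a ≥ b` are zero); and for column `a`, level `lvl ≤ t` and `l < 3` the private row with
the single entry `2^{lvl}` in column `a` when `l` is below the `lvl`-th base-`4` digit of the
deficit of column `a`. [folklore] -/
def gramRows (X : Matrix (Fin n) (Fin n) ℤ) (t : ℕ) : GramRow n t → Fin n → ℤ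
  | Sum.inl i => fun j => X i j
  | Sum.inr (Sum.inl ab) => fun j =>
      if ab.1 < ab.2 then (if j = ab.1 then colGram X ab.1 ab.2 else if j = ab.2 then -1 else 0)
      else 0
  | Sum.inr (Sum.inr q) => fun j =>
      if j = q.1 ∧ (q.2.2 : ℕ) < base4Digit (gramDeficit X t q.1) q.2.1 then 2 ^ (q.2.1 : ℕ) else 0

/-- Contribution of the pair rows to a diagonal Gram entry: `∑_{k > j} ⟨x_j,x_k⟩² + #{k < j}`. [folklore] -/
theorem sum_pairRows_mul_self (X : Matrix (Fin n) (Fin n) ℤ) (t : ℕ) (j : Fin n) :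
    ∑ ab : Fin n × Fin n, gramRows X t (Sum.inr (Sum.inl ab)) j * gramRows X t (Sum.inr (Sum.inl ab)) j
      = ∑ k : Fin n, (if j < k then colGram X j k ^ 2 else 0) +
        ∑ k : Fin n, (if k < j then (1 : ℤ) else 0) := by
  have hpt : ∀ ab : Fin n × Fin n,
      gramRows X t (Sum.inr (Sum.inl ab)) j * gramRows X t (Sum.inr (Sum.inl ab)) j =
        (if j = ab.1 then (if ab.1 < ab.2 then colGram X ab.1 ab.2 ^ 2 else 0) else 0) +
        (if j = ab.2 then (if ab.1 < ab.2 then 1 else 0) else 0) := by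
    rintro ⟨a, b⟩
    simp only [gramRows]
    by_cases hab : a < b
    · have hne : a ≠ b := ne_of_lt hab
      by_cases hja : j = a
      · subst hja
        simp [hab, hne]; ring
      · by_cases hjb : j = b
        · subst hjb; simp [hab, hja]
        · simp [hab, hja, hjb]
    · simp [hab]
  rw [Finset.sum_congr rfl fun ab _ => hpt ab, Finset.sum_add_distrib, Fintype.sum_prod_type,
    Fintype.sum_prod_type]
  congr 1
  · rw [Finset.sum_comm]
    simp only [Finset.sum_ite_eq, Finset.mem_univ, if_true]
  · simp only [Finset.sum_ite_eq, Finset.mem_univ, if_true]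

/-- Contribution of the pair rows to an off-diagonal Gram entry: `−⟨x_j, x_k⟩`. [folklore] -/
theorem sum_pairRows_mul_of_ne (X : Matrix (Fin n) (Fin n) ℤ) (t : ℕ) {j k : Fin n} (hjk : j ≠ k) :
    ∑ ab : Fin n × Fin n, gramRows X t (Sum.inr (Sum.inl ab)) j * gramRows X t (Sum.inr (Sum.inl ab)) k
      = -colGram X j k := by
  have hpt : ∀ ab : Fin n × Fin n,
      gramRows X t (Sum.inr (Sum.inl ab)) j * gramRows X t (Sum.inr (Sum.inl ab)) k =
        (if j = ab.1 then (if k = ab.2 then (if ab.1 < ab.2 then -colGram X ab.1 ab.2 else 0) else 0)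
          else 0) +
        (if k = ab.1 then (if j = ab.2 then (if ab.1 < ab.2 then -colGram X ab.1 ab.2 else 0) else 0)
          else 0) := by
    rintro ⟨a, b⟩
    simp only [gramRows]
    by_cases hab : a < b
    · have hne : a ≠ b := ne_of_lt hab
      by_cases hja : j = a
      · subst hja
        have hkj : k ≠ j := fun h => hjk h.symm
        by_cases hkb : k = b
        · subst hkb; simp [hab, hkj]
        · simp [hab, hkj, hkb]
      · by_cases hjb : j = b
        · subst hjb
          have hkj : k ≠ j := fun h => hjk h.symm
          by_cases hka : k = a
          · subst hka; simp [hab, hja]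
          · simp [hab, hja, hka, hkj]
        · simp [hab, hja, hjb]
    · simp [hab]
  rw [Finset.sum_congr rfl fun ab _ => hpt ab, Finset.sum_add_distrib, Fintype.sum_prod_type,
    Fintype.sum_prod_type]
  rw [Finset.sum_comm, Finset.sum_comm (f := fun a b => if k = a then _ else (0 : ℤ))]
  simp only [Finset.sum_ite_eq, Finset.mem_univ, if_true]
  rcases lt_trichotomy j k with h | h | h
  · simp [h, not_lt.mpr h.le]
  · exact absurd h hjk
  · simp [h, not_lt.mpr h.le, colGram_comm X k j]

/-- Contribution of the private rows: the deficit on the diagonal (base-`4` expansion), zero off the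
diagonal. [folklore] -/
theorem sum_privRows_mul (X : Matrix (Fin n) (Fin n) ℤ) (t : ℕ) (ht : ∀ j, pairDiag X j ≤ 4 ^ t)
    (j k : Fin n) :
    ∑ q : Fin n × (Fin (t + 1) × Fin 3),
        gramRows X t (Sum.inr (Sum.inr q)) j * gramRows X t (Sum.inr (Sum.inr q)) k
      = if j = k then (gramDeficit X t j : ℤ) else 0 := by
  have hpt : ∀ q : Fin n × (Fin (t + 1) × Fin 3),
      gramRows X t (Sum.inr (Sum.inr q)) j * gramRows X t (Sum.inr (Sum.inr q)) k =
        if j = q.1 then (if k = q.1 then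
          (if (q.2.2 : ℕ) < base4Digit (gramDeficit X t q.1) q.2.1 then (4 : ℤ) ^ (q.2.1 : ℕ) else 0)
          else 0) else 0 := by
    rintro ⟨a, lvl, l⟩
    simp only [gramRows]
    by_cases hja : j = a
    · subst hja
      by_cases hkj : k = j
      · subst hkj
        by_cases hl : (l : ℕ) < base4Digit (gramDeficit X t k) lvl
        · simp only [hl, and_self, if_true]
          rw [← mul_pow]; norm_num
        · simp [hl]
      · simp [hkj]
    · simp [hja]
  rw [Finset.sum_congr rfl fun q _ => hpt q, Fintype.sum_prod_type]
  simp only [Finset.sum_ite_irrel, Finset.sum_const_zero, Finset.sum_ite_eq, Finset.mem_univ,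
    if_true]
  by_cases hjk : j = k
  · subst hjk
    simp only [if_true]
    rw [Fintype.sum_prod_type]
    have hdig : ∀ lvl : Fin (t + 1), ∑ l : Fin 3,
        (if (l : ℕ) < base4Digit (gramDeficit X t j) lvl then (4 : ℤ) ^ (lvl : ℕ) else 0) =
          (base4Digit (gramDeficit X t j) lvl : ℤ) * 4 ^ (lvl : ℕ) := fun lvl =>
      sum_fin_three_ite_lt _ (base4Digit_lt _ _) _
    rw [Finset.sum_congr rfl fun lvl _ => hdig lvl]
    have hd : gramDeficit X t j < 4 ^ (t + 1) := by
      have : (gramDeficit X t j : ℤ) ≤ 4 ^ t := by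
        unfold gramDeficit
        rw [Int.toNat_of_nonneg (sub_nonneg.mpr (ht j))]
        linarith [pairDiag_nonneg X j]
      have h4 : (4 : ℤ) ^ t < 4 ^ (t + 1) := pow_lt_pow_right₀ (by norm_num) (Nat.lt_succ_self t)
      exact_mod_cast this.trans_lt h4
    exact_mod_cast sum_base4Digit_mul_pow (t + 1) (gramDeficit X t j) hd
  · rw [if_neg hjk, if_neg (fun h => hjk h.symm)]

/-- **The integer Gram identity.** At any precision `t` with `pairDiag X j ≤ 4^t` for all `j`, the
columns of `gramRows X t` are orthogonal with squared norm `4^t`: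
`∑_r (gramRows X t r j)(gramRows X t r k) = 4^t · [j = k]`. [folklore] -/
theorem sum_gramRows_mul (X : Matrix (Fin n) (Fin n) ℤ) (t : ℕ) (ht : ∀ j, pairDiag X j ≤ 4 ^ t)
    (j k : Fin n) :
    ∑ r : GramRow n t, gramRows X t r j * gramRows X t r k = if j = k then 4 ^ t else 0 := by
  rw [Fintype.sum_sum_type, Fintype.sum_sum_type, sum_privRows_mul X t ht]
  have htop : ∑ i : Fin n, gramRows X t (Sum.inl i) j * gramRows X t (Sum.inl i) k = colGram X j k :=
    rfl
  rw [htop]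
  by_cases hjk : j = k
  · subst hjk
    rw [sum_pairRows_mul_self, if_pos rfl, if_pos rfl]
    unfold gramDeficit
    rw [Int.toNat_of_nonneg (sub_nonneg.mpr (ht j))]
    unfold pairDiag
    ring
  · rw [sum_pairRows_mul_of_ne X t hjk, if_neg hjk, if_neg hjk]
    ring

/-- The number of completion rows (modes beyond the first `n`): `n² + 3n(t+1)`. [folklore] -/
def gramExtra (n t : ℕ) : ℕ := n * n + n * ((t + 1) * 3)

/-- Reindexing of the rows by `Fin (n + gramExtra n t)`, the block `X` first. [folklore] -/
def gramRowEquiv (n t : ℕ) : GramRow n t ≃ Fin (n + gramExtra n t) :=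
  (Equiv.sumCongr (Equiv.refl (Fin n))
    ((Equiv.sumCongr finProdFinEquiv
        ((Equiv.prodCongr (Equiv.refl (Fin n)) finProdFinEquiv).trans finProdFinEquiv)).trans
      finSumFinEquiv)).trans finSumFinEquiv

/-- The rows of `X` are reindexed to the first `n` rows. [folklore] -/
theorem gramRowEquiv_inl (n t : ℕ) (i : Fin n) :
    gramRowEquiv n t (Sum.inl i) = Fin.castAdd (gramExtra n t) i :=
  rfl

/-- The integer-pair entries (real parts `gramRows`, imaginary parts `0`) of the BosonSampling
instance attached to `X` at precision `t`, in the input format of `encodingBosonInput`. [folklore] -/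
def gramEntries (X : Matrix (Fin n) (Fin n) ℤ) (t : ℕ) :
    Fin (n + gramExtra n t) → Fin n → ℤ × ℤ :=
  fun r j => (gramRows X t ((gramRowEquiv n t).symm r) j, 0)

/-- The instance matrix is `2^{-t} · gramRows` (real). [folklore] -/
theorem bosonMatrix_gramEntries_apply (X : Matrix (Fin n) (Fin n) ℤ) (t : ℕ)
    (r : Fin (n + gramExtra n t)) (j : Fin n) :
    bosonMatrix n (gramExtra n t) t (gramEntries X t) r j =
      ((gramRows X t ((gramRowEquiv n t).symm r) j : ℝ) / 2 ^ t : ℝ) := by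
  simp [bosonMatrix, gramEntries, dyadicComplex]

/-- **Exact dyadic column-orthonormal embedding** (replaces AA13 Lemma 4.4 for integer matrices):
at any precision `t` with `pairDiag X j ≤ 4^t` for all `j`, the `(n + gramExtra n t) × n` matrix
`A = 2^{-t} · gramRows X t`, whose entries are the dyadic Gaussian rationals
`dyadicComplex t (gramEntries X t r j)`, is exactly column-orthonormal, `AᴴA = 1`. (AA13 use
instead `εX` on top of the Cholesky factor of `I − ε² XᴴX`, Lemma 4.4, p. 178, which is not
dyadic.) [cite: AaronsonArkhipovToC2013, Lemma 4.4 (p. 178), exact-dyadic replacement] -/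
theorem isColumnOrthonormal_gram (X : Matrix (Fin n) (Fin n) ℤ) (t : ℕ)
    (ht : ∀ j, pairDiag X j ≤ 4 ^ t) :
    IsColumnOrthonormal (bosonMatrix n (gramExtra n t) t (gramEntries X t)) := by
  unfold IsColumnOrthonormal
  ext j k
  rw [Matrix.mul_apply, Matrix.one_apply]
  simp_rw [Matrix.conjTranspose_apply, bosonMatrix_gramEntries_apply, Complex.star_def,
    Complex.conj_ofReal, ← Complex.ofReal_mul]
  rw [← Complex.ofReal_sum]
  have key : ∑ r : Fin (n + gramExtra n t),
      (gramRows X t ((gramRowEquiv n t).symm r) j : ℝ) / 2 ^ t *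
        ((gramRows X t ((gramRowEquiv n t).symm r) k : ℝ) / 2 ^ t) =
      ((∑ r : GramRow n t, gramRows X t r j * gramRows X t r k : ℤ) : ℝ) / 4 ^ t := by
    rw [← (gramRowEquiv n t).sum_comp]
    simp only [Equiv.symm_apply_apply]
    push_cast
    rw [Finset.sum_div]
    refine Finset.sum_congr rfl fun r _ => ?_
    have h4 : (4 : ℝ) ^ t = 2 ^ t * 2 ^ t := by rw [← mul_pow]; norm_num
    rw [h4]
    field_simp
  rw [key, sum_gramRows_mul X t ht]
  split_ifs <;> simp

/-- The top `n × n` block of the instance is `2^{-t} X`. (AA13 eq. (4.22): `U_{n,n} = εX`.) [cite: AaronsonArkhipovToC2013, proof of Thm. 1.1, eq. (4.22) (p. 178)] -/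
theorem bosonMatrix_gramEntries_castAdd (X : Matrix (Fin n) (Fin n) ℤ) (t : ℕ) (i j : Fin n) :
    bosonMatrix n (gramExtra n t) t (gramEntries X t) (Fin.castAdd (gramExtra n t) i) j =
      ((X i j : ℝ) / 2 ^ t : ℝ) := by
  rw [bosonMatrix_gramEntries_apply, ← gramRowEquiv_inl, Equiv.symm_apply_apply]
  rfl

/-- The permanent commutes with the cast `ℤ → ℂ`. [folklore] -/
theorem permanent_map_intCast (X : Matrix (Fin n) (Fin n) ℤ) :
    (X.map (Int.cast : ℤ → ℂ)).permanent = (X.permanent : ℂ) := by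
  simp [Matrix.permanent, Matrix.map_apply]

/-- The row selection of the planted outcome `s = (0, …, n−1)` is the block `2^{-t} X`. [cite: AaronsonArkhipovToC2013, proof of Thm. 1.1, eq. (4.22) (p. 178)] -/
theorem submatrix_gram_castAdd (X : Matrix (Fin n) (Fin n) ℤ) (t : ℕ) :
    (bosonMatrix n (gramExtra n t) t (gramEntries X t)).submatrix (Fin.castAdd (gramExtra n t)) id
      = ((2 : ℂ) ^ t)⁻¹ • X.map (Int.cast : ℤ → ℂ) := by
  ext i j
  simp only [Matrix.submatrix_apply, id, bosonMatrix_gramEntries_castAdd, Matrix.smul_apply,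
    Matrix.map_apply, smul_eq_mul]
  push_cast
  ring

/-- `Per(A_s) = Per(X) / 2^{tn}` for the planted outcome. (AA13 eqs. (4.22)–(4.23).) [cite: AaronsonArkhipovToC2013, proof of Thm. 1.1, eqs. (4.22)–(4.23) (p. 178)] -/
theorem permanent_submatrix_gram (X : Matrix (Fin n) (Fin n) ℤ) (t : ℕ) :
    ((bosonMatrix n (gramExtra n t) t (gramEntries X t)).submatrix
        (Fin.castAdd (gramExtra n t)) id).permanent = (X.permanent : ℂ) / 2 ^ (t * n) := by
  rw [submatrix_gram_castAdd, Matrix.permanent_smul, Fintype.card_fin, permanent_map_intCast,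
    inv_pow, ← pow_mul, div_eq_inv_mul]

/-- `|Per(A_s)|² = Per(X)² / 4^{tn}` for the planted outcome. (AA13 eq. (4.23):
`p_A = ε^{2n} Per(X)²`.) [cite: AaronsonArkhipovToC2013, proof of Thm. 1.1, eq. (4.23) (p. 178)] -/
theorem norm_sq_permanent_submatrix_gram (X : Matrix (Fin n) (Fin n) ℤ) (t : ℕ) :
    ‖((bosonMatrix n (gramExtra n t) t (gramEntries X t)).submatrix
        (Fin.castAdd (gramExtra n t)) id).permanent‖ ^ 2 = (X.permanent : ℝ) ^ 2 / 4 ^ (t * n) := by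
  rw [permanent_submatrix_gram, norm_div, div_pow, Complex.norm_intCast, norm_pow,
    Complex.norm_ofNat, sq_abs, ← pow_mul, show (4 : ℝ) = 2 ^ 2 by norm_num, ← pow_mul]
  ring_nf

/-! ### The hard instances and the probability of the planted outcome (AA13 eqs. (4.20)–(4.23)) -/

/-- `PMF.map` along an injective map, evaluated on the image. [folklore] -/
theorem pmf_map_apply_of_injective {α β : Type*} (p : PMF α) {f : α → β}
    (hf : Function.Injective f) (a : α) : (p.map f) (f a) = p a := by
  rw [PMF.map_apply, tsum_eq_single a]
  · rw [if_pos rfl]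
  · intro a' ha'
    rw [if_neg (fun h => ha' (hf h).symm)]

/-- On a column-orthonormal instance, the encoded BosonSampling problem gives the encoded outcome
`s` probability `|Per(A_s)|²/n!` (given the normalisation fact `bosonSamplingPMF_apply` of
`SamplingProblems.lean`). (AA13 §1.1 eq. (1.3); Thm. 3.10.) [cite: AaronsonArkhipovToC2013, Thm. 3.10 (p. 171) with eq. (1.3)] -/
theorem bosonSamplingProblem_encode_encodeBosonOutcome (n e b : ℕ) [NeZero (n + e)]
    (happly : bosonSamplingPMF_apply (m := n + e) (n := n))
    (entries : Fin (n + e) → Fin n → ℤ × ℤ)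
    (hA : IsColumnOrthonormal (bosonMatrix n e b entries)) (s : Fin n → Fin (n + e)) :
    bosonSamplingProblem (encodingBosonInput.encode ⟨n, e, b, entries⟩) (encodeBosonOutcome s) =
      ENNReal.ofReal (bosonWeight (bosonMatrix n e b entries) s) := by
  rw [bosonSamplingProblem_encode_of_isColumnOrthonormal n e b entries hA,
    pmf_map_apply_of_injective _ (encodeBosonOutcome_injective _ _), happly hA (Nat.le_add_right n e)]

/-- The code of the BosonSampling instance attached to `X` at precision `t`
(`⟨n, gramExtra n t, t, gramEntries X t⟩` under `encodingBosonInput`). [folklore] -/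
def gramInstanceCode (X : Matrix (Fin n) (Fin n) ℤ) (t : ℕ) : List Bool :=
  encodingBosonInput.encode ⟨n, gramExtra n t, t, gramEntries X t⟩

/-- The code of the planted outcome: photon `i` in mode `i` for `i < n` (AA13's outcome `1_n`,
eq. (4.20), in the ordered refinement). [cite: AaronsonArkhipovToC2013, proof of Thm. 1.1, eq. (4.20) (p. 178)] -/
def diagOutcomeCode (n t : ℕ) : List Bool :=
  encodeBosonOutcome (Fin.castAdd (gramExtra n t) : Fin n → Fin (n + gramExtra n t))

/-- **The probability of the planted outcome** (AA13 eqs. (4.20)–(4.23) for the tree's instances):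
for `n ≥ 1` and a precision `t` dominating the deficits, the BosonSampling problem on the instance
of `X` gives the planted outcome probability `Per(X)² / (4^{tn} · n!)` (given the normalisation fact
`bosonSamplingPMF_apply`). [cite: AaronsonArkhipovToC2013, proof of Thm. 1.1, eqs. (4.20)–(4.23) (p. 178)] -/
theorem toReal_bosonSamplingProblem_gramInstance (X : Matrix (Fin n) (Fin n) ℤ) (hn : 0 < n)
    (t : ℕ) (ht : ∀ j, pairDiag X j ≤ 4 ^ t)
    (happly : bosonSamplingPMF_apply (m := n + gramExtra n t) (n := n)) :
    (bosonSamplingProblem (gramInstanceCode X t) (diagOutcomeCode n t)).toReal =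
      (X.permanent : ℝ) ^ 2 / (4 ^ (t * n) * n.factorial) := by
  haveI : NeZero (n + gramExtra n t) := NeZero.of_pos (Nat.add_pos_left hn _)
  rw [gramInstanceCode, diagOutcomeCode,
    bosonSamplingProblem_encode_encodeBosonOutcome _ _ _ happly _ (isColumnOrthonormal_gram X t ht),
    ENNReal.toReal_ofReal (bosonWeight_nonneg _ _), bosonWeight,
    norm_sq_permanent_submatrix_gram, div_div]

end GramCompletion

/-! ### Approximating `Per(X)²` of integer matrices: coin-taking oracles (AA13 Thm. 4.3) -/

/-- Boolean encoding of square integer matrices `⟨n, X⟩`, `X : Fin n → Fin n → ℤ` (row-major,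
`encodingFinVec` over `encodingIntBool`, assembled with `sigmaBool`). (AA13 Thm. 4.2/4.3: the input
"a matrix `X`"; Arora–Barak 2009, §0.1.) [cite: AaronsonArkhipovToC2013, Thm. 4.3 (p. 176), input format] -/
def encodingIntMatrix : Encoding (Σ n : ℕ, Fin n → Fin n → ℤ) Bool :=
  Encoding.sigmaBool fun n => encodingFinVec (encodingFinVec encodingIntBool n) n

/-- The window of acceptable answers of a factor-`g` approximation of `Per(X)²`: natural numbers
`z` with `Per(X)²/g ≤ z ≤ g · Per(X)²` (AA13 eq. (4.2)). [cite: AaronsonArkhipovToC2013, Thm. 4.3, eq. (4.2) (p. 176)] -/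
def perSqWindow (g : ℝ) {n : ℕ} (X : Fin n → Fin n → ℤ) : Set ℕ :=
  {z | ((Matrix.of X).permanent : ℝ) ^ 2 / g ≤ z ∧ (z : ℝ) ≤ g * ((Matrix.of X).permanent : ℝ) ^ 2}

/-- `Per(X)²` itself is an acceptable answer for every `g ≥ 1` (so integer answers lose nothing). [folklore] -/
theorem sq_permanent_mem_perSqWindow {g : ℝ} (hg : 1 ≤ g) {n : ℕ} (X : Fin n → Fin n → ℤ) :
    (Matrix.of X).permanent.natAbs ^ 2 ∈ perSqWindow g X := by
  simp only [perSqWindow, Set.mem_setOf_eq, Nat.cast_pow, Nat.cast_natAbs, Int.cast_abs, sq_abs]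
  have h0 : 0 ≤ ((Matrix.of X).permanent : ℝ) ^ 2 := sq_nonneg _
  constructor
  · rw [div_le_iff₀ (by linarith)]
    nlinarith
  · nlinarith

/-- The query `⟨⟨X, 1^k⟩, u⟩` to a coin-taking `Per²`-oracle: the matrix code, the confidence
parameter `k = 1/δ` in unary, and the coin string `u` (AA13's convention for randomised oracles,
Thm. 1.1, p. 149, and the input convention `⟨x, 0^{1/ε}⟩` of Def. 2.4, p. 163). [cite: AaronsonArkhipovToC2013, Def. 2.4 (p. 163) with Thm. 1.1 (p. 149)] -/
def perSqQuery {n : ℕ} (X : Fin n → Fin n → ℤ) (k : ℕ) (u : List Bool) : List Bool :=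
  boolPair (boolPair (encodingIntMatrix.encode ⟨n, X⟩) (unaryEncodeNat k)) u

/-- Reading a `Per²`-query: `⟨⟨q, 1^k⟩, u⟩ ↦ (q, k, u)` (through `boolUnpair`'s junk convention on
malformed strings). [folklore] -/
def perSqParse (w : List Bool) : List Bool × ℕ × List Bool :=
  ((boolUnpair (boolUnpair w).1).1, unaryDecodeNat (boolUnpair (boolUnpair w).1).2, (boolUnpair w).2)

/-- `perSqParse` inverts `perSqQuery`. [folklore] -/
@[simp] theorem perSqParse_perSqQuery {n : ℕ} (X : Fin n → Fin n → ℤ) (k : ℕ) (u : List Bool) :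
    perSqParse (perSqQuery X k u) = (encodingIntMatrix.encode ⟨n, X⟩, k, u) := by
  simp [perSqParse, perSqQuery, unary_decode_encode_nat]

/-- `PerSqRandOracleSolves g 𝒪`: the coin-taking oracle `𝒪` approximates `Per(X)²` of square integer
matrices to within the factor `g`, in the sense a randomised algorithm does (AA13 Def. 2.4 with
the randomised-oracle convention of Thm. 1.1): for some polynomial `c`, for all `n ≥ 1`, all
`X ∈ ℤ^{n×n}`, all `k ≥ 1` and every coin length `ℓ ≥ c(|⟨X⟩| + k)`, the answer to `⟨⟨X, 1^k⟩, u⟩`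
read as a natural number lies in `[Per(X)²/g, g · Per(X)²]` (eq. (4.2)) for all but a fraction
`≤ 1/k` of the coin strings `u ∈ {0,1}^ℓ` (the oracle reads a prefix of its random tape, hence
"every `ℓ ≥ c`"). AA13's Thm. 4.3 oracle takes real matrices; the queries of its proof are the
matrices `X^{[r]}` (eq. (4.3), `r` rational), integral after clearing the denominator of the first
row, so integer matrices suffice. [cite: AaronsonArkhipovToC2013, Thm. 4.3, eq. (4.2) (p. 176) with Def. 2.4 (p. 163)] -/
def PerSqRandOracleSolves (g : ℝ) (O : Oracle) : Prop :=
  ∃ c : Polynomial ℕ, ∀ (n : ℕ) (X : Fin n → Fin n → ℤ) (k ℓ : ℕ), 0 < n → 0 < k →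
    c.eval ((encodingIntMatrix.encode ⟨n, X⟩).length + k) ≤ ℓ →
      uniformProb ℓ {u | decodeNat (O (perSqQuery X k u)) ∉ perSqWindow g X} ≤ 1 / (k : ℝ)

/-- **AA13 Theorem 4.3 (hardness of approximating `Per(X)²`), in the randomised-oracle form in
which the proof of Thm. 1.1 consumes it.** "The following problem is `#P`-hard, for any
`g ∈ [1, poly(n)]`: given a real matrix `X ∈ ℝ^{n×n}`, approximate `Per(X)²` to within a
multiplicative factor of `g`" (p. 176); proof: with an oracle `𝒪` satisfying (4.2), `Per(X)` of a
0/1 matrix — `#P`-complete by Valiant's Thm. 4.2 — is computed exactly in polynomial time with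
`O(g n² log n)` adaptive queries `X^{[r]}` (binary search, (4.3)–(4.19)). Used on p. 178 as: "So to
prove the theorem, it suffices to show how to approximate `Per(X)²` in `FBPP^{NP^𝒪}`", i.e. for a
*randomised* approximator (a union bound over the polynomially many queries, each asked with
confidence `1/k = 1/(3 · #queries)` and fresh coins fixed by the `BPP` machine). Tree form, for
constant factors `g ≥ 1` (a sub-case of `[1, poly(n)]`): every coin-taking oracle that
`g`-approximates `Per²` of integer matrices (`PerSqRandOracleSolves g 𝒪`) gives `P^{#P} ⊆ BPP^{𝒪}`.
The shape is that of `PermanentOfGaussiansConjectureRand` (the worst-case, exact-precision analogue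
of PGC, which AA13 prove). Stated as a `Prop`; see the module docstring for what a discharge needs.
[cite: AaronsonArkhipovToC2013, Thm. 4.3 (p. 176) with Thm. 4.2 (p. 175) and proof of Thm. 1.1 (p. 178)] -/
def PSharpP_subset_BPPRel_of_perSqRandOracleSolves : Prop :=
  ∀ (g : ℝ) (O : Oracle), 1 ≤ g → PerSqRandOracleSolves g O → PSharpP ⊆ BPPRel O

/-- The exact `Per²`-oracle: it answers `Per(X)²` in binary, ignoring the confidence parameter and
the coins (junk `[]` on malformed queries). [folklore] -/
def exactPerSqOracle : Oracle := fun w =>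
  match encodingIntMatrix.decode (perSqParse w).1 with
  | none => []
  | some ⟨_, X⟩ => encodeNat ((Matrix.of X).permanent.natAbs ^ 2)

/-- The exact oracle solves `Per²`-approximation for every factor `g ≥ 1`, with no coins: the
hypothesis of `PSharpP_subset_BPPRel_of_perSqRandOracleSolves` is satisfiable (by the `#P`-hard
exact oracle, of course). [folklore] -/
theorem perSqRandOracleSolves_exactPerSqOracle {g : ℝ} (hg : 1 ≤ g) :
    PerSqRandOracleSolves g exactPerSqOracle := by
  refine ⟨0, fun n X k ℓ _ hk _ => ?_⟩
  have hans : ∀ u, decodeNat (exactPerSqOracle (perSqQuery X k u)) =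
      (Matrix.of X).permanent.natAbs ^ 2 := by
    intro u
    simp only [exactPerSqOracle, perSqParse_perSqQuery, encodingIntMatrix.decode_encode,
      decode_encodeNat]
  have hempty : {u | decodeNat (exactPerSqOracle (perSqQuery X k u)) ∉ perSqWindow g X} = ∅ := by
    ext u
    simp only [Set.mem_setOf_eq, Set.mem_empty_iff_false, iff_false, not_not, hans]
    exact sq_permanent_mem_perSqWindow hg X
  rw [hempty, uniformProb_empty]
  positivity

/-! ### The sampler's coin predicate (where Stockmeyer counting is applied) -/

/-- The coin predicate of a classical sampler `A`: the strings `⟨⟨x, y⟩, r⟩` with `A(x; r) = y`.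
Counting its witnesses `r ∈ {0,1}^{coinLen |x|}` at the instance `⟨x, y⟩` gives
`2^{coinLen |x|} · Pr_r[A(x; r) = y]` (`toReal_outputPMF_apply`); this is the Boolean function
`r ↦ [𝒪(A, r) = 1_n]` of AA13 eq. (4.20) to which Thm. 4.1 is applied (p. 178). [cite: AaronsonArkhipovToC2013, proof of Thm. 1.1, eq. (4.20) (p. 178)] -/
def samplerRel (A : RandAlg (List Bool) (List Bool)) : Language Bool :=
  {w | A.run (boolUnpair (boolUnpair w).1).1 (boolUnpair w).2 = (boolUnpair (boolUnpair w).1).2}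

/-- Membership of a well-formed string in the coin predicate. [folklore] -/
@[simp] theorem boolPair_boolPair_mem_samplerRel (A : RandAlg (List Bool) (List Bool))
    (x y r : List Bool) : boolPair (boolPair x y) r ∈ samplerRel A ↔ A.run x r = y := by
  change A.run (boolUnpair (boolUnpair (boolPair (boolPair x y) r)).1).1
      (boolUnpair (boolPair (boolPair x y) r)).2 =
    (boolUnpair (boolUnpair (boolPair (boolPair x y) r)).1).2 ↔ _
  simp only [boolUnpair_boolPair]

/-- **Output probabilities are witness counts**: `Pr_r[A(x; r) = y] = #{r ∈ {0,1}^m | ⟨⟨x,y⟩,r⟩ ∈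
samplerRel A} / 2^m` with `m = coinLen |x|`. (Arora–Barak 2009, §7.1; AA13 eq. (4.20).) [cite: AaronsonArkhipovToC2013, proof of Thm. 1.1, eq. (4.20) (p. 178)] -/
theorem toReal_outputPMF_apply (A : RandAlg (List Bool) (List Bool)) (x y : List Bool) :
    (A.outputPMF id x y).toReal =
      (countWitnesses (samplerRel A) (A.coinLen x.length) (boolPair x y) : ℝ) /
        2 ^ A.coinLen x.length := by
  classical
  have h1 : (A.outputPMF id x y).toReal =
      uniformProb (A.coinLen x.length) {r | A.run x r = y} := by
    rw [uniformProb_eq_toOuterMeasure, ← PMF.toOuterMeasure_apply_singleton, RandAlg.outputPMF,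
      PMF.toOuterMeasure_map_apply]
    rfl
  rw [h1, uniformProb, countWitnesses]
  congr 2
  refine Finset.card_bij (fun r _ => r) (fun r hr => ?_) (fun _ _ _ _ h => h) (fun r hr => ⟨r, ?_, rfl⟩)
  · simp only [Finset.mem_filter, Finset.mem_univ, true_and, Set.mem_setOf_eq] at hr ⊢
    exact (boolPair_boolPair_mem_samplerRel A x y _).2 hr
  · simp only [Finset.mem_filter, Finset.mem_univ, true_and, Set.mem_setOf_eq] at hr ⊢
    exact (boolPair_boolPair_mem_samplerRel A x y _).1 hr

/-- **The coin predicate of a polynomial-time sampler is in `P`**: deciding `A(x; r) = y` on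
`⟨⟨x, y⟩, r⟩` takes the two pairing projections (`PairProjections.lean`), one run of `A`
(`IsPPT A id`: `(x, r) ↦ A(x; r)` is polynomial-time on `⟨x, r⟩`) and a string comparison
(Arora–Barak 2009, Def. 7.1 and the remark after it: a PTM is a deterministic TM on the pair
(input, coins)). A discharge is a composition of these machines (`PolyTimeComputable.comp_holds`);
stated as a `Prop`. [cite: AroraBarak2009, Def. 7.1 and the remark after it] -/
def samplerRel_mem_P : Prop :=
  ∀ A : RandAlg (List Bool) (List Bool), IsPPT A id → samplerRel A ∈ P

/-- **Discharge of `samplerRel_mem_P`.** The coin predicate is the equality test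
`{w | F w = G w}` of the two polynomial-time maps `F : w = ⟨⟨x, y⟩, r⟩ ↦ A(x; r)` (the sampler as
a string function `⟨x, r⟩ ↦ A(x; r)` is in `FP` by `IsPPT` — polynomial time on all coin strings —,
`PolyTimeComputable.comp_holds`, `polyTimeComputable_boolUnpair`, wired by the fan-out `fanoutFn`
and the pairing projections of `PairProjections.lean`) and `G : w ↦ y`; such tests are in `P`
(`setOf_apply_eq_apply_mem_P`, via the string-equality language `EqPair ∈ P` of
`StringEquality.lean`). (Arora–Barak 2009, Def. 7.1 and the remark after it.) [cite: AroraBarak2009, Def. 7.1 and the remark after it] -/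
theorem samplerRel_mem_P_holds : samplerRel_mem_P := by
  intro A hA
  have hrun : (Function.uncurry A.run ∘ boolUnpair) ∈ FP :=
    PolyTimeComputable.comp_holds hA.1 polyTimeComputable_boolUnpair
  have hfst : (fun z : List Bool => (boolUnpair z).1) ∈ FP := boolUnpairFst_mem_FP
  have hsnd : (fun z : List Bool => (boolUnpair z).2) ∈ FP := boolUnpairSnd_mem_FP
  have hF : ((Function.uncurry A.run ∘ boolUnpair) ∘
      fanoutFn ((fun z : List Bool => (boolUnpair z).1) ∘ fun z : List Bool => (boolUnpair z).1)
        (fun z : List Bool => (boolUnpair z).2)) ∈ FP :=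
    comp_mem_FP hrun (fanoutFn_mem_FP (comp_mem_FP hfst hfst) hsnd)
  have hG : ((fun z : List Bool => (boolUnpair z).2) ∘ fun z : List Bool => (boolUnpair z).1) ∈ FP :=
    comp_mem_FP hsnd hfst
  have hEq : samplerRel A =
      {w | ((Function.uncurry A.run ∘ boolUnpair) ∘
          fanoutFn ((fun z : List Bool => (boolUnpair z).1) ∘ fun z : List Bool => (boolUnpair z).1)
            (fun z : List Bool => (boolUnpair z).2)) w =
        ((fun z : List Bool => (boolUnpair z).2) ∘ fun z : List Bool => (boolUnpair z).1) w} := by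
    ext w
    simp only [samplerRel, Function.comp_apply, fanoutFn_apply, boolUnpair_boolPair,
      Function.uncurry_apply_pair]
  rw [hEq]
  exact setOf_apply_eq_apply_mem_P hF hG

/-- **`FP^O` is closed under polynomial-time pre- and post-processing**: if `F ∈ FP^O` and
`pre, post ∈ FP`, then `w ↦ post ⟨w, F (pre w)⟩` is in `FP^O` (compute `pre w`, run the transducer
forwarding its queries, then run `post` on the input paired with the answer). Folklore companion
of `PRel_subset_PRel_of_mem_FPRel` (Arora–Barak 2009, §3.4, Example 3.6 (2) with Remark 3.8); in
the transcript model of `Oracle.lean` the composite step function is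
`(w, answers) ↦ (stepF (pre w, answers)).map id (post ∘ boolPair w)`, polynomial-time by
`PolyTimeComputable.comp_holds` and `mapFstFn_mem_FP`, with the same rounds and queries as `F` on
`pre w`. Stated as a `Prop`. [cite: AroraBarak2009, §3.4 Example 3.6 (2) with Remark 3.8] -/
def FPRel_comp_FP : Prop :=
  ∀ (O : Oracle) (F pre post : List Bool → List Bool), F ∈ FPRel O → pre ∈ FP → post ∈ FP →
    (fun w => post (boolPair w (F (pre w)))) ∈ FPRel O

/-- **Discharge of `FPRel_comp_FP`** by the transcript-model closure theorem `postPre_mem_FPRel`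
(`Complexity/OracleClosure.lean`: the composite oracle algorithm `M.prePost pre post`, whose step
function is polynomial-time by `PolyTimeComputable.firstField` and finite-state selection). [cite: AroraBarak2009, §3.4 Example 3.6 (2) with Remark 3.8] -/
theorem FPRel_comp_FP_holds : FPRel_comp_FP :=
  fun _ _ _ _ hF hpre hpost => postPre_mem_FPRel hF hpre hpost

/-! ### The reduction: from a `Per²`-query to a count query and back -/

section Reduction

variable {n : ℕ}

/-- Pre-processing of a matrix code `q = ⟨X⟩`: the pair `⟨x₀, y₀⟩` of the codes of the BosonSampling
instance of `X` at its canonical precision and of the planted outcome (junk `[]` if `q` does not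
decode). (AA13 p. 178: "Let us feed `A` as input to `𝒪` and consider the probability `p_A` that `𝒪`
outputs `1_n`".) [cite: AaronsonArkhipovToC2013, proof of Thm. 1.1 (p. 178)] -/
def bosonPre (q : List Bool) : List Bool :=
  match encodingIntMatrix.decode q with
  | none => []
  | some ⟨n, X⟩ =>
    boolPair (gramInstanceCode (Matrix.of X) (gramPrecision (Matrix.of X)))
      (diagOutcomeCode n (gramPrecision (Matrix.of X)))

/-- `bosonPre` on a well-formed code. [folklore] -/
theorem bosonPre_encode (X : Fin n → Fin n → ℤ) :
    bosonPre (encodingIntMatrix.encode ⟨n, X⟩) =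
      boolPair (gramInstanceCode (Matrix.of X) (gramPrecision (Matrix.of X)))
        (diagOutcomeCode n (gramPrecision (Matrix.of X))) := by
  simp only [bosonPre, encodingIntMatrix.decode_encode]

/-- The number of coins the sampler uses on the instance coded by `q`: `qA |x₀|` for the sampler's
coin polynomial `qA`. [folklore] -/
def bosonCoinLen (qA : Polynomial ℕ) (q : List Bool) : ℕ :=
  qA.eval (boolUnpair (bosonPre q)).1.length

/-- The number of coins the Stockmeyer counter is given for the query `⟨⟨q, 1^k⟩, ·⟩`:
`cS (|⟨x₀, y₀⟩| + qA |x₀| + 1 + k)` for its coin polynomial `cS` (accuracy `kη = 1`, confidence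
`kδ = k`). [folklore] -/
def bosonCoinBound (qA cS : Polynomial ℕ) (q : List Bool) (k : ℕ) : ℕ :=
  cS.eval ((bosonPre q).length + bosonCoinLen qA q + 1 + k)

/-- Pre-processing of a `Per²`-query `w = ⟨⟨q, 1^k⟩, u⟩` into the count query
`⟨⟨x₀, y₀⟩, 1^m, 1^1, 1^k, u↾ℓ'⟩` (`countQuery`: instance `⟨x₀, y₀⟩` of the coin predicate, witness
length `m = qA |x₀|`, accuracy factor `1 + 1/1 = 2`, confidence `1/k`, and the prefix of the coins
the counter needs). [cite: AaronsonArkhipovToC2013, proof of Thm. 1.1 (p. 178): "by Theorem 4.1, we can approximate p_A"] -/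
def bosonCountQuery (qA cS : Polynomial ℕ) (w : List Bool) : List Bool :=
  countQuery (bosonPre (perSqParse w).1) (bosonCoinLen qA (perSqParse w).1) 1 (perSqParse w).2.1
    ((perSqParse w).2.2.take (bosonCoinBound qA cS (perSqParse w).1 (perSqParse w).2.1))

/-- The rescaling of a count `N` (read as the probability estimate `N / 2^m`) to an estimate of
`Per(X)²`: `⌈(N / 2^m) · 4^{tn} · n!⌉` (inverting `p_A = Per(X)² / (4^{tn} n!)`, eq. (4.23)). [cite: AaronsonArkhipovToC2013, proof of Thm. 1.1, eq. (4.23) (p. 178)] -/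
def bosonRescale (n t N m : ℕ) : ℕ :=
  ⌈((N * (4 ^ (t * n) * n.factorial) : ℕ) : ℚ) / 2 ^ m⌉₊

/-- Post-processing `⟨w, a⟩ ↦ ⌈(a / 2^m) · 4^{tn} · n!⌉` (in binary), where `w = ⟨⟨q, 1^k⟩, u⟩` is the
original `Per²`-query (supplying `n`, the precision `t` and `m = qA |x₀|`) and `a` the counter's
answer (junk `[]` if `q` does not decode). [cite: AaronsonArkhipovToC2013, proof of Thm. 1.1, eq. (4.23) (p. 178)] -/
def bosonCountPost (qA : Polynomial ℕ) (z : List Bool) : List Bool :=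
  match encodingIntMatrix.decode (perSqParse (boolUnpair z).1).1 with
  | none => []
  | some ⟨n, X⟩ =>
    encodeNat (bosonRescale n (gramPrecision (Matrix.of X)) (decodeNat (boolUnpair z).2)
      (bosonCoinLen qA (perSqParse (boolUnpair z).1).1))

/-- **The coin-taking `Per²`-oracle built from a sampler**, given the sampler's coin polynomial `qA`
and a Stockmeyer counter `F` (with coin polynomial `cS`) for its coin predicate:
`w ↦ bosonCountPost ⟨w, F (bosonCountQuery w)⟩`. This is the `FBPP^{NP}` procedure of AA13's proof
of Thm. 1.1 (p. 178) written as a deterministic function of (query, coins). [cite: AaronsonArkhipovToC2013, proof of Thm. 1.1 (p. 178)] -/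
def bosonPerSqOracle (qA cS : Polynomial ℕ) (F : List Bool → List Bool) : Oracle :=
  fun w => bosonCountPost qA (boolPair w (F (bosonCountQuery qA cS w)))

/-- **The reduction maps are polynomial-time** (folklore book-keeping; AA13 Lemma 4.4: "`U` can be
computed in polynomial time given `X`", here for the explicit integer construction `gramEntries`):
`bosonPre` (the Gram rows, `gramPrecision` — a logarithm of a sum of squares —, the encodings),
`bosonCountQuery` (additionally two pairing projections, a polynomial evaluation written in unary
and a prefix of the coins) and `bosonCountPost` (decoding, the product `a · 4^{tn} · n!`, a shift by
`m` bits with rounding up, binary encoding) are in `FP`. Stated as a `Prop` (a discharge is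
TM-level programming of these arithmetic maps). [cite: AaronsonArkhipovToC2013, Lemma 4.4 (p. 178), polynomial-time computability] -/
def bosonReduction_mem_FP : Prop :=
  bosonPre ∈ FP ∧ (∀ qA cS : Polynomial ℕ, bosonCountQuery qA cS ∈ FP) ∧
    ∀ qA : Polynomial ℕ, bosonCountPost qA ∈ FP

/-- The oracle's answer on a well-formed query, unfolded: the rescaled Stockmeyer estimate of the
number of coin strings on which the sampler outputs the planted outcome. [folklore] -/
theorem decodeNat_bosonPerSqOracle_perSqQuery (qA cS : Polynomial ℕ) (F : List Bool → List Bool)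
    (X : Fin n → Fin n → ℤ) (k : ℕ) (u : List Bool) :
    decodeNat (bosonPerSqOracle qA cS F (perSqQuery X k u)) =
      bosonRescale n (gramPrecision (Matrix.of X))
        (countEstimate F (bosonPre (encodingIntMatrix.encode ⟨n, X⟩))
          (bosonCoinLen qA (encodingIntMatrix.encode ⟨n, X⟩)) 1 k
          (u.take (bosonCoinBound qA cS (encodingIntMatrix.encode ⟨n, X⟩) k)))
        (bosonCoinLen qA (encodingIntMatrix.encode ⟨n, X⟩)) := by
  simp only [bosonPerSqOracle, bosonCountPost, bosonCountQuery, boolUnpair_boolPair,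
    perSqParse_perSqQuery, encodingIntMatrix.decode_encode, decode_encodeNat, countEstimate]

/-! ### The arithmetic of the estimate -/

/-- `⌈(N/2^m) · M⌉ ≥ (N/2^m) · M` for `M = 4^{tn} n!`. [folklore] -/
theorem bosonRescale_ge (n t N m : ℕ) :
    (N : ℝ) / 2 ^ m * (4 ^ (t * n) * n.factorial) ≤ bosonRescale n t N m := by
  unfold bosonRescale
  set K : ℕ := N * (4 ^ (t * n) * n.factorial) with hK
  have h : ((K : ℚ) / 2 ^ m : ℚ) ≤ (⌈(K : ℚ) / 2 ^ m⌉₊ : ℚ) := Nat.le_ceil _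
  have h' := (Rat.cast_le (K := ℝ)).2 h
  push_cast at h'
  calc (N : ℝ) / 2 ^ m * (4 ^ (t * n) * n.factorial) = (K : ℝ) / 2 ^ m := by
        rw [hK]; push_cast; ring
    _ ≤ _ := h'

/-- `⌈(N/2^m) · M⌉ < (N/2^m) · M + 1`. [folklore] -/
theorem bosonRescale_lt (n t N m : ℕ) :
    (bosonRescale n t N m : ℝ) < (N : ℝ) / 2 ^ m * (4 ^ (t * n) * n.factorial) + 1 := by
  unfold bosonRescale
  set K : ℕ := N * (4 ^ (t * n) * n.factorial) with hK
  have h : (⌈(K : ℚ) / 2 ^ m⌉₊ : ℚ) < (K : ℚ) / 2 ^ m + 1 := Nat.ceil_lt_add_one (by positivity)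
  have h' := (Rat.cast_lt (K := ℝ)).2 h
  push_cast at h'
  calc _ < (K : ℝ) / 2 ^ m + 1 := h'
    _ = _ := by rw [hK]; push_cast; ring

/-- **The real-arithmetic core.** If `P ∈ {0} ∪ [1, ∞)` (an integer square), the sampler is within
the factor `c ≥ 1` of `P/M` (`P/M/c ≤ p ≤ c · P/M`), the count is within the factor `2` of `p`
(`p/2 ≤ u ≤ 2p`), and `z` is `u · M` rounded up (`u M ≤ z < u M + 1`, and `z < 1 ⟹ z = 0`), then
`P/(2c+1) ≤ z ≤ (2c+1) · P`: the rounding costs at most `1 ≤ P` when `P ≥ 1`, and nothing when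
`P = 0`. [folklore] -/
theorem rescale_bounds {P M c p u z : ℝ} (hc : 1 ≤ c) (hM : 0 < M) (hP : 0 ≤ P)
    (hPint : P = 0 ∨ 1 ≤ P) (hm1 : P / M / c ≤ p) (hm2 : p ≤ c * (P / M)) (hlo : p / 2 ≤ u)
    (hhi : u ≤ 2 * p) (hge : u * M ≤ z) (hlt : z < u * M + 1)
    (hz : z < 1 → z = 0) : P / (2 * c + 1) ≤ z ∧ z ≤ (2 * c + 1) * P := by
  have hc0 : 0 < c := by linarith
  have h1 : P / (2 * c) ≤ u * M := by
    have h2 : P / M / c / 2 ≤ u := by linarith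
    calc P / (2 * c) = P / M / c / 2 * M := by field_simp
      _ ≤ u * M := by nlinarith
  have h2 : u * M ≤ 2 * c * P := by
    have h3 : u ≤ 2 * (c * (P / M)) := by linarith
    calc u * M ≤ 2 * (c * (P / M)) * M := by nlinarith
      _ = 2 * c * P := by field_simp
  constructor
  · calc P / (2 * c + 1) ≤ P / (2 * c) :=
          div_le_div_of_nonneg_left hP (by linarith) (by linarith)
      _ ≤ u * M := h1
      _ ≤ z := hge
  · rcases hPint with hP0 | hP1
    · have hu0 : u * M ≤ 0 := by rw [hP0] at h2; linarith
      have hz0 : z = 0 := hz (by linarith)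
      rw [hz0, hP0]; linarith
    · calc z ≤ u * M + 1 := hlt.le
        _ ≤ 2 * c * P + P := by linarith
        _ = (2 * c + 1) * P := by ring

/-- `Per(X)²` of an integer matrix is `0` or `≥ 1`. [folklore] -/
theorem permanent_sq_eq_zero_or_one_le (X : Matrix (Fin n) (Fin n) ℤ) :
    (X.permanent : ℝ) ^ 2 = 0 ∨ 1 ≤ (X.permanent : ℝ) ^ 2 := by
  by_cases h : X.permanent = 0
  · left; simp [h]
  · right
    have habs : (1 : ℝ) ≤ |(X.permanent : ℝ)| := by
      rw [← Int.cast_abs]; exact_mod_cast Int.one_le_abs h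
    calc (1 : ℝ) = 1 ^ 2 := by ring
      _ ≤ |(X.permanent : ℝ)| ^ 2 := pow_le_pow_left₀ zero_le_one habs 2
      _ = (X.permanent : ℝ) ^ 2 := sq_abs _

/-- A factor-`2` approximate count `N` of `W` witnesses among the `2^m` coin strings, read as a
probability `N/2^m`, is within the factor `2` of `p = W/2^m`. [folklore] -/
theorem approxCount_one_div_bounds {W N m : ℕ} {p : ℝ} (hp : p = (W : ℝ) / 2 ^ m)
    (hN : IsApproxCount 1 W N) : p / 2 ≤ (N : ℝ) / 2 ^ m ∧ (N : ℝ) / 2 ^ m ≤ 2 * p := by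
  obtain ⟨h1, h2⟩ := hN
  have h2m : (0 : ℝ) < 2 ^ m := pow_pos two_pos m
  norm_num at h1 h2
  subst hp
  constructor
  · rw [div_right_comm]
    exact div_le_div_of_nonneg_right h1 h2m.le
  · rw [← mul_div_assoc]
    exact div_le_div_of_nonneg_right h2 h2m.le

/-- **The estimate is in the window.** For a sampler within the factor `c ≥ 1` of
`bosonSamplingProblem`, using exactly `qA |x|` coins, and a count `N` within the factor `2` of the
number of its coin strings producing the planted outcome on the instance of `X` (`n ≥ 1`), the
rescaled value `⌈(N/2^m) · 4^{tn} n!⌉` is within the factor `2c + 1` of `Per(X)²` (given the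
normalisation fact `bosonSamplingPMF_apply`). This is eqs. (4.20)–(4.23) combined with the two
approximation guarantees. [cite: AaronsonArkhipovToC2013, proof of Thm. 1.1, eqs. (4.20)–(4.23) (p. 178)] -/
theorem bosonRescale_mem_perSqWindow {A : RandAlg (List Bool) (List Bool)} {c : ℝ} (hc : 1 ≤ c)
    (hmul : A.SamplesMultiplicative bosonSamplingProblem c) {qA : Polynomial ℕ}
    (hqA : ∀ m, A.coinLen m = qA.eval m)
    (happly : ∀ m n : ℕ, bosonSamplingPMF_apply (m := m) (n := n))
    (X : Fin n → Fin n → ℤ) (hn : 0 < n) {N : ℕ}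
    (hN : IsApproxCount 1
      (countWitnesses (samplerRel A) (bosonCoinLen qA (encodingIntMatrix.encode ⟨n, X⟩))
        (bosonPre (encodingIntMatrix.encode ⟨n, X⟩))) N) :
    bosonRescale n (gramPrecision (Matrix.of X)) N
        (bosonCoinLen qA (encodingIntMatrix.encode ⟨n, X⟩)) ∈ perSqWindow (2 * c + 1) X := by
  -- name the quantities
  set t : ℕ := gramPrecision (Matrix.of X) with ht_def
  set x₀ : List Bool := gramInstanceCode (Matrix.of X) t with hx₀
  set y₀ : List Bool := diagOutcomeCode n t with hy₀
  have hpre : bosonPre (encodingIntMatrix.encode ⟨n, X⟩) = boolPair x₀ y₀ := bosonPre_encode X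
  have hm : bosonCoinLen qA (encodingIntMatrix.encode ⟨n, X⟩) = A.coinLen x₀.length := by
    rw [bosonCoinLen, hpre, boolUnpair_boolPair, hqA]
  rw [hm, hpre] at hN
  rw [hm]
  set m : ℕ := A.coinLen x₀.length with hm_def
  set p : ℝ := (A.outputPMF id x₀ y₀).toReal with hp
  set P : ℝ := ((Matrix.of X).permanent : ℝ) ^ 2 with hP
  set M : ℝ := 4 ^ (t * n) * (n.factorial : ℝ) with hM
  have ht : ∀ j, pairDiag (Matrix.of X) j ≤ 4 ^ t := pairDiag_le_gramPrecision (Matrix.of X)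
  have hD : (bosonSamplingProblem x₀ y₀).toReal = P / M :=
    toReal_bosonSamplingProblem_gramInstance (Matrix.of X) hn t ht (happly _ _)
  have hm12 : (bosonSamplingProblem x₀ y₀).toReal / c ≤ p ∧
      p ≤ c * (bosonSamplingProblem x₀ y₀).toReal := hmul x₀ y₀
  rw [hD] at hm12
  -- the count as a probability estimate
  have hcount : p = (countWitnesses (samplerRel A) m (boolPair x₀ y₀) : ℝ) / 2 ^ m :=
    toReal_outputPMF_apply A x₀ y₀
  obtain ⟨hlo, hhi⟩ := approxCount_one_div_bounds hcount hN
  have hz : (bosonRescale n t N m : ℝ) < 1 → (bosonRescale n t N m : ℝ) = 0 := fun hz1 => by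
    have : bosonRescale n t N m < 1 := by exact_mod_cast hz1
    rw [Nat.lt_one_iff.mp this, Nat.cast_zero]
  have hM0 : 0 < M :=
    mul_pos (pow_pos (by norm_num) _) (Nat.cast_pos.2 (Nat.factorial_pos n))
  exact rescale_bounds hc hM0 (sq_nonneg _) (permanent_sq_eq_zero_or_one_le (Matrix.of X))
    hm12.1 hm12.2 hlo hhi (bosonRescale_ge n t N m) (bosonRescale_lt n t N m) hz

end Reduction

/-! ### The oracle built from a uniform sampler solves `Per²`-approximation -/

/-- `uniformProb m` is monotone in the event. [folklore] -/
theorem uniformProb_mono_set {m : ℕ} {E E' : Set (List Bool)} (h : E ⊆ E') :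
    uniformProb m E ≤ uniformProb m E' := by
  classical
  unfold uniformProb
  refine div_le_div_of_nonneg_right ?_ (by positivity)
  exact_mod_cast Finset.card_le_card fun r hr => by
    simp only [Finset.mem_filter, Finset.mem_univ, true_and] at hr ⊢
    exact h hr

/-- **The oracle built from a uniform factor-`c` sampler `(2c+1)`-approximates `Per²`.** If the
sampler is within the factor `c ≥ 1` of `bosonSamplingProblem` and uses exactly `qA |x|` coins, `F`
is a Stockmeyer counter for its coin predicate with coin polynomial `cS` (the conclusion of
`stockmeyerApproxCounting`), and `|bosonPre q| ≤ r |q|` for a polynomial `r`, then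
`bosonPerSqOracle qA cS F` answers within `[Per(X)²/(2c+1), (2c+1) Per(X)²]` except for a fraction
`≤ 1/k` of the coin strings of every length `ℓ ≥ cS(r(s) + qA(r(s)) + 1 + s)`, `s = |⟨X⟩| + k`
(given the normalisation fact `bosonSamplingPMF_apply`). (AA13 p. 178: "by Theorem 4.1, we can
approximate `p_A` to within a multiplicative factor of `g` in `FBPP^{NP^𝒪}`. It follows that we can
approximate `|Per(X)|² = Per(X)²` in `FBPP^{NP^𝒪}` as well.") [cite: AaronsonArkhipovToC2013, proof of Thm. 1.1 (p. 178)] -/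
theorem perSqRandOracleSolves_bosonPerSqOracle {A : RandAlg (List Bool) (List Bool)} {c : ℝ}
    (hc : 1 ≤ c) (hmul : A.SamplesMultiplicative bosonSamplingProblem c) {qA : Polynomial ℕ}
    (hqA : ∀ m, A.coinLen m = qA.eval m)
    (happly : ∀ m n : ℕ, bosonSamplingPMF_apply (m := m) (n := n))
    {F : List Bool → List Bool} {cS : Polynomial ℕ}
    (hF : ∀ (x : List Bool) (m kη kδ : ℕ), 0 < kη → 0 < kδ →
      uniformProb (cS.eval (x.length + m + kη + kδ))
        {u | ¬ IsApproxCount kη (countWitnesses (samplerRel A) m x) (countEstimate F x m kη kδ u)} ≤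
          1 / (kδ : ℝ))
    {r : Polynomial ℕ} (hr : ∀ q, (bosonPre q).length ≤ r.eval q.length) :
    PerSqRandOracleSolves (2 * c + 1) (bosonPerSqOracle qA cS F) := by
  refine ⟨cS.comp (r + qA.comp r + 1 + Polynomial.X), fun n X k ℓ hn hk hℓ => ?_⟩
  set q : List Bool := encodingIntMatrix.encode ⟨n, X⟩ with hq
  set ℓ' : ℕ := bosonCoinBound qA cS q k with hℓ'
  -- the counter's coins fit into the supplied ones
  have hℓ'ℓ : ℓ' ≤ ℓ := by
    refine le_trans ?_ hℓ
    rw [hℓ', bosonCoinBound, Polynomial.eval_comp]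
    refine TM2Iter.eval_mono cS ?_
    simp only [Polynomial.eval_add, Polynomial.eval_comp, Polynomial.eval_one, Polynomial.eval_X]
    have h1 : (bosonPre q).length ≤ r.eval (q.length + k) :=
      (hr q).trans (TM2Iter.eval_mono r (Nat.le_add_right _ _))
    have h2 : bosonCoinLen qA q ≤ qA.eval (r.eval (q.length + k)) := by
      unfold bosonCoinLen
      exact TM2Iter.eval_mono qA ((length_boolUnpair_fst_le _).trans h1)
    omega
  -- bad coins for the oracle have a bad prefix for the counter
  set Bad : Set (List Bool) := {u' | ¬ IsApproxCount 1
      (countWitnesses (samplerRel A) (bosonCoinLen qA q) (bosonPre q))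
      (countEstimate F (bosonPre q) (bosonCoinLen qA q) 1 k u')} with hBad
  have hsub : {u | decodeNat (bosonPerSqOracle qA cS F (perSqQuery X k u)) ∉
      perSqWindow (2 * c + 1) X} ⊆ {u | u.take ℓ' ∈ Bad} := by
    intro u hu
    simp only [Set.mem_setOf_eq, hBad] at hu ⊢
    intro hgood
    apply hu
    rw [decodeNat_bosonPerSqOracle_perSqQuery]
    exact bosonRescale_mem_perSqWindow hc hmul hqA happly X hn hgood
  calc uniformProb ℓ {u | decodeNat (bosonPerSqOracle qA cS F (perSqQuery X k u)) ∉
          perSqWindow (2 * c + 1) X}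
      ≤ uniformProb ℓ {u | u.take ℓ' ∈ Bad} := uniformProb_mono_set hsub
    _ = uniformProb ℓ' Bad := uniformProb_take_of_le hℓ'ℓ Bad
    _ ≤ 1 / (k : ℝ) := by
        rw [hBad, hℓ', bosonCoinBound]
        exact hF (bosonPre q) (bosonCoinLen qA q) 1 k one_pos hk

/-! ### The corrected statement and its proof from the named facts -/

/-- **The uniform exact-sampling hypothesis**: some *uniform* probabilistic polynomial-time
algorithm — `IsPPT A id` together with an exactly polynomial coin budget `A.coinLen = q` (Gill's
uniform machine, as in `mem_BPP_iff_randAlg`; without this conjunct `coinLen |x|` is `O(log)` advice,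
module docstring) — samples `bosonSamplingProblem` to within a constant multiplicative factor
`c ≥ 1` (AA13's "exact" case in the robust form stated after Thm. 1.1, §1.2.1 p. 150–151: "if the
oracle `𝒪` samples from some distribution whose probabilities are all multiplicatively close to
those in `𝒟_A`, then we still get the conclusion"). [cite: AaronsonArkhipovToC2013, Thm. 1.1 (p. 149) with the multiplicative remark (pp. 150–151)] -/
@[conjecture] def UniformExactBosonSampling : Prop :=
  ∃ A : RandAlg (List Bool) (List Bool), IsPPT A id ∧ (∃ q : Polynomial ℕ, ∀ n, A.coinLen n = q.eval n) ∧
    ∃ c : ℝ, 1 ≤ c ∧ A.SamplesMultiplicative bosonSamplingProblem c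

/-- **Corrected form of quantum-advantage.S20** (Aaronson–Arkhipov, ToC 9 (2013), Thm. 1.1 with
Cor. 4.5, exact case in the multiplicative-error form of §1.2.1). If BosonSampling
(`bosonSamplingProblem`) is sampled to within a constant multiplicative factor by a *uniform*
probabilistic polynomial-time classical algorithm (`UniformExactBosonSampling`), then
`P^{#P} ⊆ BPP^{NP}` (AA13 write `P^{#P} = BPP^{NP}`; `⊇` is classical), hence the polynomial
hierarchy collapses to the third level (Toda, Cor. 4.5).

Discrepancy with the retired S20 (`PSharpP_subset_BPPRelClass_NP_of_exactBosonSampling`, same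
cite, deleted from `Sampling.lean` on 2026-08-14): S20 omitted the exact-polynomial coin budget, so
its sampler could depend on the non-computable quantity `coinLen |x|` (advice), whereas AA13's
sampler is a uniform randomised algorithm and the proof (Stockmeyer counting over
`r ∈ {0,1}^{poly(n)}`, Thm. 4.1) needs the number of coins; with advice the printed proof gives
only `P^{#P} ⊆ BPP^{NP}/log`. Hence S20 asserted more than the source (it trivially implied this
statement, a uniform sampler being in particular a sampler); see the module docstring.
`PSharpP_subset_BPPRelClass_NP_of_uniformExactBosonSampling_of_facts` proves this statement from
AA13 Thm. 4.3, Stockmeyer's Thm. 4.1 and polynomial-time book-keeping, along the printed proof.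
[cite: AaronsonArkhipovToC2013, Thm. 1.1 (p. 149; proof §4.1 p. 178) with Cor. 4.5 (p. 178)] -/
def PSharpP_subset_BPPRelClass_NP_of_uniformExactBosonSampling : Prop :=
  UniformExactBosonSampling → PSharpP ⊆ BPPRelClass NP

/-- `NP` relative to the empty oracle is `NP`, given `P^∅ = P`. [cite: BakerGillSolovay1975, §1] -/
theorem NPRel_empty_of_PRel_empty (hPe : PRel_empty) : NPRel Oracle.empty = NP := by
  rw [NPRel, hPe]
  rfl

/-- **The corrected S20 from its printed ingredients** (AA13, proof of Thm. 1.1, p. 178). Let `A` be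
a uniform sampler within the factor `c` of `bosonSamplingProblem`, with coin polynomial `qA`.
Its coin predicate `samplerRel A` is in `P = P^∅` (`samplerRel_mem_P`, `PRel_empty`), so
Stockmeyer counting (`stockmeyerApproxCounting`, Thm. 4.1) provides `L ∈ NP^∅ = NP` and a counter
`F ∈ FP^L`; the oracle `𝒪 = bosonPerSqOracle qA cS F` — embed `X` exactly-dyadically
(`isColumnOrthonormal_gram`, replacing Lemma 4.4), count the coins on which `A` outputs the
planted outcome, rescale by `4^{tn} n!` (eqs. (4.20)–(4.23)) — `(2c+1)`-approximates `Per²`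
(`perSqRandOracleSolves_bosonPerSqOracle`) and lies in `FP^L` (`FPRel_comp_FP`,
`bosonReduction_mem_FP`); by Thm. 4.3 (`PSharpP_subset_BPPRel_of_perSqRandOracleSolves`)
`P^{#P} ⊆ BPP^{𝒪} ⊆ BPP^{L} ⊆ BPP^{NP}` (`PRel_subset_PRel_of_mem_FPRel` through `BP·`). The
normalisation `𝒟_A(s) = |Per(A_s)|²/n!` is the fact `bosonSamplingPMF_apply` of
`SamplingProblems.lean`. [cite: AaronsonArkhipovToC2013, Thm. 1.1, proof (p. 178)] -/
theorem PSharpP_subset_BPPRelClass_NP_of_uniformExactBosonSampling_of_facts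
    (hnorm : ∀ m n : ℕ, bosonSamplingPMF_apply (m := m) (n := n))
    (hStock : stockmeyerApproxCounting) (hPe : PRel_empty)
    (hcomp : PRel_subset_PRel_of_mem_FPRel)
    (hHard : PSharpP_subset_BPPRel_of_perSqRandOracleSolves)
    (hRel : samplerRel_mem_P) (hFP : FPRel_comp_FP) (hRed : bosonReduction_mem_FP) :
    PSharpP_subset_BPPRelClass_NP_of_uniformExactBosonSampling := by
  rintro ⟨A, hA, ⟨qA, hqA⟩, c, hc, hmul⟩
  have hR : samplerRel A ∈ PRel Oracle.empty := by
    rw [hPe]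
    exact hRel A hA
  obtain ⟨L, hL, F, hF, cS, hS⟩ := hStock Oracle.empty (samplerRel A) hR
  have hLNP : L ∈ NP := by rwa [NPRel_empty_of_PRel_empty hPe] at hL
  obtain ⟨hpreFP, hqueryFP, hpostFP⟩ := hRed
  obtain ⟨r, hr⟩ := exists_poly_length_le_of_mem_FP hpreFP
  have hO : bosonPerSqOracle qA cS F ∈ FPRel (Oracle.ofLanguage L) :=
    hFP _ F _ _ hF (hqueryFP qA cS) (hpostFP qA)
  have hsolves : PerSqRandOracleSolves (2 * c + 1) (bosonPerSqOracle qA cS F) :=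
    perSqRandOracleSolves_bosonPerSqOracle hc hmul hqA hnorm hS hr
  calc PSharpP ⊆ BPPRel (bosonPerSqOracle qA cS F) := hHard (2 * c + 1) _ (by linarith) hsolves
    _ ⊆ BPPRel (Oracle.ofLanguage L) := BPPRel_subset_BPPRel_of_mem_FPRel hcomp hO
    _ ⊆ BPPRelClass NP := BPPRel_subset_BPPRelClass hLNP

/-- **The corrected S20 from its printed ingredients**, with the normalisation
`𝒟_A(s) = |Per(A_s)|²/n!` fed in from its discharge `bosonSamplingPMF_apply_holds`
(`Cryptography/SamplingProblemsProofs.lean`): only the complexity-theoretic named facts remain as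
hypotheses. [cite: AaronsonArkhipovToC2013, Thm. 1.1, proof (p. 178)] -/
theorem PSharpP_subset_BPPRelClass_NP_of_uniformExactBosonSampling_of_facts'
    (hStock : stockmeyerApproxCounting) (hPe : PRel_empty)
    (hcomp : PRel_subset_PRel_of_mem_FPRel)
    (hHard : PSharpP_subset_BPPRel_of_perSqRandOracleSolves)
    (hRel : samplerRel_mem_P) (hFP : FPRel_comp_FP) (hRed : bosonReduction_mem_FP) :
    PSharpP_subset_BPPRelClass_NP_of_uniformExactBosonSampling :=
  PSharpP_subset_BPPRelClass_NP_of_uniformExactBosonSampling_of_facts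
    (fun _ _ => bosonSamplingPMF_apply_holds) hStock hPe hcomp hHard hRel hFP hRed

/-- **The corrected S20 from its printed ingredients**, with the normalisation and the coin
predicate discharged (`bosonSamplingPMF_apply_holds`, `samplerRel_mem_P_holds`): the remaining
hypotheses are Stockmeyer's theorem, `P^∅ = P`, `P^{FP^L} ⊆ P^L`, AA13 Thm. 4.3, `FP^L ∘ FP` and the
polynomial-time book-keeping of the reduction maps. [cite: AaronsonArkhipovToC2013, Thm. 1.1, proof (p. 178)] -/
theorem PSharpP_subset_BPPRelClass_NP_of_uniformExactBosonSampling_of_facts''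
    (hStock : stockmeyerApproxCounting) (hPe : PRel_empty)
    (hcomp : PRel_subset_PRel_of_mem_FPRel)
    (hHard : PSharpP_subset_BPPRel_of_perSqRandOracleSolves)
    (hFP : FPRel_comp_FP) (hRed : bosonReduction_mem_FP) :
    PSharpP_subset_BPPRelClass_NP_of_uniformExactBosonSampling :=
  PSharpP_subset_BPPRelClass_NP_of_uniformExactBosonSampling_of_facts'
    hStock hPe hcomp hHard samplerRel_mem_P_holds hFP hRed

/-- **The corrected S20 from its printed ingredients**, with the normalisation, the coin
predicate, `P^∅ = P` (`PRel_empty_holds`, `Complexity/OracleEmpty.lean`) and the `FP^L ∘ FP`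
closure (`FPRel_comp_FP_holds`) discharged: the remaining hypotheses are Stockmeyer's theorem
(AA13 Thm. 4.1), `P^{FP^L} ⊆ P^L`, AA13 Thm. 4.3 and the polynomial-time book-keeping of the
reduction maps. [cite: AaronsonArkhipovToC2013, Thm. 1.1, proof (p. 178)] -/
theorem PSharpP_subset_BPPRelClass_NP_of_uniformExactBosonSampling_of_facts'''
    (hStock : stockmeyerApproxCounting) (hcomp : PRel_subset_PRel_of_mem_FPRel)
    (hHard : PSharpP_subset_BPPRel_of_perSqRandOracleSolves) (hRed : bosonReduction_mem_FP) :
    PSharpP_subset_BPPRelClass_NP_of_uniformExactBosonSampling :=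
  PSharpP_subset_BPPRelClass_NP_of_uniformExactBosonSampling_of_facts''
    hStock PRel_empty_holds hcomp hHard FPRel_comp_FP_holds hRed

end Literature.Computability.QuantumComplexity
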